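import Mathlib
import Summits.MatrixMultiplication.MatrixMultiplication.Theorems.HiddenToeplitzCornersHiddenCornerLemmaRStubDualityAnnihilator
import Summits.MatrixMultiplication.MatrixMultiplication.Theorems.HiddenToeplitzCornersHiddenCornerLemmaRHConst
import Summits.MatrixMultiplication.MatrixMultiplication.Theorems.HiddenToeplitzCornersHiddenCornerLemmaRMixedOneOne
import Summits.MatrixMultiplication.MatrixMultiplication.Theorems.HiddenToeplitzCornersHiddenCornerLemmaRGconstPOne
import Summits.MatrixMultiplication.MatrixMultiplication.Theorems.HiddenToeplitzCornersHiddenCornerLemmaRRankTwoReductionSmall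

/-!
# The hidden-corner lemma `HiddenCornerLemmaR` for displacement rank `d ≤ 1`, and for `d ≤ 2`
# conditionally on the G-constant law at `p = 2`

Assembly file for crux item `stmt-MatrixMultiplication-10752`
(`Summit.MatrixMultiplication.MatrixMultiplication.Theses.HiddenToeplitzCorners.HiddenCornerLemmaR`),
line `frobenius-dual-short-syzygies`.  The refined compression reduction
`hclR_reduction_small_classes` (S1) needs the class law `r ≤ 2p + q` only for the compression
classes `(p, q)` with `p + q ≤ d`; for `d ≤ 2` these are supplied by: the duality S2
(`stub_dualityAnnihilator`) feeding the G-constant law for `p ≤ 1` (`hclR_gconstDualLaw_p_le_one`,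
any generator) and — as a HYPOTHESIS, the one open piece — for `p = 2`; the H-constant law
`hclR_hconst_bound` (`p = 0`); and the mixed `(1,1)` law `hclR_mixed_one_one_stub`.
Results: `hclR_HiddenCornerLemmaR_d_le_one` (unconditional) and
`hclR_HiddenCornerLemmaR_d_le_two_of_p_two` (conditional on the `p = 2` G-constant law, stated
verbatim as `stub_gconstDualLaw` with `p = 2`).
-/

set_option linter.dupNamespace false

namespace Summit.MatrixMultiplication.MatrixMultiplication.Theorems

open scoped Matrix
open Summit.MatrixMultiplication.MatrixMultiplication.Cruxes.HiddenCornerLemmaR.FrobeniusDualShortSyzygies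
  (stub_dualityAnnihilator)



/-- Displacement is linear in the pencil parameter (G-constant form): if every coefficient has
`∇(T a b) = G₀ (H₁ a b)ᵀ` then `∇ T(X) = G₀ (Σ X_ab • H₁ a b)ᵀ`. -/
theorem hclR_sd_disp_eval {r N p : ℕ} (T : Fin r → Fin r → Matrix (Fin N) (Fin N) ℂ)
    (G₀ : Matrix (Fin N) (Fin p) ℂ) (H₁ : Fin r → Fin r → Matrix (Fin N) (Fin p) ℂ)
    (hdisp : ∀ a b, T a b - (Matrix.of fun i j : Fin N => if (i : ℕ) = (j : ℕ) + 1 then (1 : ℂ) else 0) * T a b * (Matrix.of fun i j : Fin N => if (i : ℕ) = (j : ℕ) + 1 then (1 : ℂ) else 0)ᵀ = G₀ * (H₁ a b)ᵀ)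
    (X : Matrix (Fin r) (Fin r) ℂ) :
    (∑ a : Fin r, ∑ b : Fin r, X a b • T a b) - (Matrix.of fun i j : Fin N => if (i : ℕ) = (j : ℕ) + 1 then (1 : ℂ) else 0) * (∑ a : Fin r, ∑ b : Fin r, X a b • T a b) * (Matrix.of fun i j : Fin N => if (i : ℕ) = (j : ℕ) + 1 then (1 : ℂ) else 0)ᵀ
      = G₀ * (∑ a : Fin r, ∑ b : Fin r, X a b • H₁ a b)ᵀ := by
  rw [Matrix.mul_sum, Matrix.sum_mul, ← Finset.sum_sub_distrib, Matrix.transpose_sum, Matrix.mul_sum]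
  refine Finset.sum_congr rfl (fun a _ => ?_)
  rw [Matrix.mul_sum, Matrix.sum_mul, ← Finset.sum_sub_distrib, Matrix.transpose_sum, Matrix.mul_sum]
  refine Finset.sum_congr rfl (fun b _ => ?_)
  rw [Matrix.mul_smul, Matrix.smul_mul, ← smul_sub, hdisp a b, Matrix.transpose_smul, Matrix.mul_smul]

/-- The class law `r ≤ 2p + q` for the compression classes with `p + q ≤ d`, `d ≤ 2`, from:
the G-constant law in dual form for `p ≤ 1` (landed) and for `p = 2` (hypothesis `h20`), the
H-constant law (landed) and the mixed `(1,1)` law (landed). -/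
theorem hclR_sd_law (h20 : ∀ (r N p : ℕ) (G₀ : Matrix (Fin N) (Fin p) ℂ) (E F : Matrix (Fin N) (Fin r) ℂ) (M : Matrix (Fin N) (Fin N) ℂ) (H : Matrix (Fin N) (Fin p) ℂ) (X₀ : Matrix (Fin r) (Fin r) ℂ), p = 2 → E.rank = r → F.rank = r → (∀ Λ : Matrix (Fin N) (Fin r) ℂ, (∀ k : Fin p, (∑ c : Fin r, (∑ j : Fin N, (((∑ i : Fin N, G₀ i k • (Matrix.of fun i j : Fin N => if (i : ℕ) = (j : ℕ) + 1 then (1 : ℂ) else 0)ᵀ ^ (i : ℕ)) *ᵥ (Λᵀ c)) j) • (Matrix.of fun i j : Fin N => if (i : ℕ) = (j : ℕ) + 1 then (1 : ℂ) else 0)ᵀ ^ (j : ℕ)) *ᵥ (Eᵀ c)) = 0) → Λᵀ * F = 0) → M - (Matrix.of fun i j : Fin N => if (i : ℕ) = (j : ℕ) + 1 then (1 : ℂ) else 0) * M * (Matrix.of fun i j : Fin N => if (i : ℕ) = (j : ℕ) + 1 then (1 : ℂ) else 0)ᵀ = G₀ * Hᵀ → M * E = F * X₀ → M.det ≠ 0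 → r ≤ 2 * p) (d : ℕ) (hd : d ≤ 2) :
    ∀ (r N p q : ℕ) (T : Fin r → Fin r → Matrix (Fin N) (Fin N) ℂ) (E F : Matrix (Fin N) (Fin r) ℂ)
      (G₀ : Matrix (Fin N) (Fin p) ℂ) (H₀ : Matrix (Fin N) (Fin q) ℂ)
      (H₁ : Fin r → Fin r → Matrix (Fin N) (Fin p) ℂ) (G₁ : Fin r → Fin r → Matrix (Fin N) (Fin q) ℂ),
      p + q ≤ d → E.rank = r → F.rank = r →
      (∀ X : Matrix (Fin r) (Fin r) ℂ, (∑ a : Fin r, ∑ b : Fin r, X a b • T a b) * E = F * X) →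
      (∀ a b, T a b - (Matrix.of fun i j : Fin N => if (i : ℕ) = (j : ℕ) + 1 then (1 : ℂ) else 0) * T a b * (Matrix.of fun i j : Fin N => if (i : ℕ) = (j : ℕ) + 1 then (1 : ℂ) else 0)ᵀ = G₀ * (H₁ a b)ᵀ + G₁ a b * H₀ᵀ) →
      (∃ X₀ : Matrix (Fin r) (Fin r) ℂ, (∑ a : Fin r, ∑ b : Fin r, X₀ a b • T a b).det ≠ 0) →
      r ≤ 2 * p + q := by
  intro r N p q T E F G₀ H₀ H₁ G₁ hpq hE hF hcorner hdisp hns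
  rcases Nat.eq_zero_or_pos q with hq | hq
  · -- G-constant classes: p ≤ 2
    subst hq
    have hdisp' : ∀ a b, T a b - (Matrix.of fun i j : Fin N => if (i : ℕ) = (j : ℕ) + 1 then (1 : ℂ) else 0) * T a b * (Matrix.of fun i j : Fin N => if (i : ℕ) = (j : ℕ) + 1 then (1 : ℂ) else 0)ᵀ = G₀ * (H₁ a b)ᵀ := by
      intro a b
      rw [hdisp a b]
      have h0 : G₁ a b * H₀ᵀ = 0 := by
        ext i j
        simp [Matrix.mul_apply]
      rw [h0, add_zero]
    obtain ⟨X₀, hX₀⟩ := hns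
    have horth := stub_dualityAnnihilator r N p T E F G₀ H₁ hcorner hdisp'
    have hM := hclR_sd_disp_eval T G₀ H₁ hdisp' X₀
    rcases Nat.lt_or_ge p 2 with hp | hp
    · have hle : r ≤ 2 * p :=
        hclR_gconstDualLaw_p_le_one r N p G₀ E F (∑ a : Fin r, ∑ b : Fin r, X₀ a b • T a b)
          (∑ a : Fin r, ∑ b : Fin r, X₀ a b • H₁ a b) X₀ (by omega) hE hF horth hM (hcorner X₀) hX₀
      omega
    · have hp2 : p = 2 := by omega
      have hle : r ≤ 2 * p :=
        h20 r N p G₀ E F (∑ a : Fin r, ∑ b : Fin r, X₀ a b • T a b)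
          (∑ a : Fin r, ∑ b : Fin r, X₀ a b • H₁ a b) X₀ hp2 hE hF horth hM (hcorner X₀) hX₀
      omega
  · rcases Nat.eq_zero_or_pos p with hp | hp
    · -- H-constant classes
      subst hp
      rcases Nat.eq_zero_or_pos r with hr | hr
      · omega
      have hFne : F ≠ 0 := by
        intro h
        rw [h, Matrix.rank_zero] at hF
        omega
      have hdisp' : ∀ a b, T a b - (Matrix.of fun i j : Fin N => if (i : ℕ) = (j : ℕ) + 1 then (1 : ℂ) else 0) * T a b * (Matrix.of fun i j : Fin N => if (i : ℕ) = (j : ℕ) + 1 then (1 : ℂ) else 0)ᵀ = G₁ a b * H₀ᵀ := by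
        intro a b
        rw [hdisp a b]
        have h0 : G₀ * (H₁ a b)ᵀ = 0 := by
          ext i j
          simp [Matrix.mul_apply]
        rw [h0, zero_add]
      have hle : r ≤ q := hclR_hconst_bound r N q T E F H₀ G₁ hFne hcorner hdisp'
      omega
    · -- mixed classes with p + q ≤ 2: p = q = 1
      have hp1 : p = 1 := by omega
      have hq1 : q = 1 := by omega
      exact hclR_mixed_one_one_stub r N p q T E F G₀ H₀ H₁ G₁ hp1 hq1 hp hq hE hF hcorner hdisp hns

/-- **`HiddenCornerLemmaR` for displacement rank `d ≤ 2`, conditionally on the G-constant law at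
`p = 2`** (the hypothesis `h20` is `stub_gconstDualLaw` restricted to `p = 2`, the one open piece). -/
theorem hclR_HiddenCornerLemmaR_d_le_two_of_p_two (h20 : ∀ (r N p : ℕ) (G₀ : Matrix (Fin N) (Fin p) ℂ) (E F : Matrix (Fin N) (Fin r) ℂ) (M : Matrix (Fin N) (Fin N) ℂ) (H : Matrix (Fin N) (Fin p) ℂ) (X₀ : Matrix (Fin r) (Fin r) ℂ), p = 2 → E.rank = r → F.rank = r → (∀ Λ : Matrix (Fin N) (Fin r) ℂ, (∀ k : Fin p, (∑ c : Fin r, (∑ j : Fin N, (((∑ i : Fin N, G₀ i k • (Matrix.of fun i j : Fin N => if (i : ℕ) = (j : ℕ) + 1 then (1 : ℂ) else 0)ᵀ ^ (i : ℕ)) *ᵥ (Λᵀ c)) j) • (Matrix.of fun i j : Fin N => if (i : ℕ) = (j : ℕ) + 1 then (1 : ℂ) else 0)ᵀ ^ (j : ℕ)) *ᵥ (Eᵀ c)) = 0) → Λᵀ * F = 0) → M - (Matrix.of fun i j : Fin N => if (i : ℕ) = (j : ℕ) + 1 then (1 : ℂ) else 0) * M * (Matrix.of fun i j : Fin N =>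 if (i : ℕ) = (j : ℕ) + 1 then (1 : ℂ) else 0)ᵀ = G₀ * Hᵀ → M * E = F * X₀ → M.det ≠ 0 → r ≤ 2 * p) :
    ∀ (r N d : ℕ) (T : Fin r → Fin r → Matrix (Fin N) (Fin N) ℂ) (E F : Matrix (Fin N) (Fin r) ℂ),
      d ≤ 2 → E.rank = r → F.rank = r →
      (∀ X : Matrix (Fin r) (Fin r) ℂ, (∑ a : Fin r, ∑ b : Fin r, X a b • T a b) * E = F * X) →
      (∀ X : Matrix (Fin r) (Fin r) ℂ, ((∑ a : Fin r, ∑ b : Fin r, X a b • T a b) -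
        (Matrix.of fun i j : Fin N => if (i : ℕ) = (j : ℕ) + 1 then (1 : ℂ) else 0) * (∑ a : Fin r, ∑ b : Fin r, X a b • T a b) * (Matrix.of fun i j : Fin N => if (i : ℕ) = (j : ℕ) + 1 then (1 : ℂ) else 0)ᵀ).rank ≤ d) →
      (∃ X₀ : Matrix (Fin r) (Fin r) ℂ, (∑ a : Fin r, ∑ b : Fin r, X₀ a b • T a b).det ≠ 0) →
      r ≤ 2 * d := by
  intro r N d T E F hd hE hF hcorner hrank hns
  exact hclR_reduction_small_classes d hd (hclR_sd_law h20 d hd) r N T E F hE hF hcorner hrank hns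

/-- **`HiddenCornerLemmaR` for displacement rank `d ≤ 1` (unconditional).** -/
theorem hclR_HiddenCornerLemmaR_d_le_one :
    ∀ (r N d : ℕ) (T : Fin r → Fin r → Matrix (Fin N) (Fin N) ℂ) (E F : Matrix (Fin N) (Fin r) ℂ),
      d ≤ 1 → E.rank = r → F.rank = r →
      (∀ X : Matrix (Fin r) (Fin r) ℂ, (∑ a : Fin r, ∑ b : Fin r, X a b • T a b) * E = F * X) →
      (∀ X : Matrix (Fin r) (Fin r) ℂ, ((∑ a : Fin r, ∑ b : Fin r, X a b • T a b) -
        (Matrix.of fun i j : Fin N => if (i : ℕ) = (j : ℕ) + 1 then (1 : ℂ) else 0) * (∑ a : Fin r, ∑ b : Fin r, X a b • T a b) * (Matrix.of fun i j : Fin N => if (i : ℕ) = (j : ℕ) + 1 then (1 : ℂ) else 0)ᵀ).rank ≤ d) →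
      (∃ X₀ : Matrix (Fin r) (Fin r) ℂ, (∑ a : Fin r, ∑ b : Fin r, X₀ a b • T a b).det ≠ 0) →
      r ≤ 2 * d := by
  intro r N d T E F hd hE hF hcorner hrank hns
  -- the `p = 2` law is never invoked when `d ≤ 1`; supply it vacuously through the `d`-restricted law
  refine hclR_reduction_small_classes d (by omega) ?_ r N T E F hE hF hcorner hrank hns
  intro r N p q T E F G₀ H₀ H₁ G₁ hpq
  have hp2 : p ≤ 1 := by omega
  -- reuse the general small-class law with a dummy `p = 2` hypothesis discharged by `p ≤ 1`
  intro hE hF hcorner hdisp hns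
  rcases Nat.eq_zero_or_pos q with hq | hq
  · subst hq
    have hdisp' : ∀ a b, T a b - (Matrix.of fun i j : Fin N => if (i : ℕ) = (j : ℕ) + 1 then (1 : ℂ) else 0) * T a b * (Matrix.of fun i j : Fin N => if (i : ℕ) = (j : ℕ) + 1 then (1 : ℂ) else 0)ᵀ = G₀ * (H₁ a b)ᵀ := by
      intro a b
      rw [hdisp a b]
      have h0 : G₁ a b * H₀ᵀ = 0 := by
        ext i j
        simp [Matrix.mul_apply]
      rw [h0, add_zero]
    obtain ⟨X₀, hX₀⟩ := hns
    have horth := stub_dualityAnnihilator r N p T E F G₀ H₁ hcorner hdisp'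
    have hM := hclR_sd_disp_eval T G₀ H₁ hdisp' X₀
    have hle : r ≤ 2 * p :=
      hclR_gconstDualLaw_p_le_one r N p G₀ E F (∑ a : Fin r, ∑ b : Fin r, X₀ a b • T a b)
        (∑ a : Fin r, ∑ b : Fin r, X₀ a b • H₁ a b) X₀ hp2 hE hF horth hM (hcorner X₀) hX₀
    omega
  · have hp0 : p = 0 := by omega
    subst hp0
    rcases Nat.eq_zero_or_pos r with hr | hr
    · omega
    have hFne : F ≠ 0 := by
      intro h
      rw [h, Matrix.rank_zero] at hF
      omega
    have hdisp' : ∀ a b, T a b - (Matrix.of fun i j : Fin N => if (i : ℕ) = (j : ℕ) + 1 then (1 : ℂ) else 0) * T a b * (Matrix.of fun i j : Fin N => if (i : ℕ) = (j : ℕ) + 1 then (1 : ℂ) else 0)ᵀ = G₁ a b * H₀ᵀ := by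
      intro a b
      rw [hdisp a b]
      have h0 : G₀ * (H₁ a b)ᵀ = 0 := by
        ext i j
        simp [Matrix.mul_apply]
      rw [h0, zero_add]
    have hle : r ≤ q := hclR_hconst_bound r N q T E F H₀ G₁ hFne hcorner hdisp'
    omega

end Summit.MatrixMultiplication.MatrixMultiplication.Theorems
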